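import Summits.Ventures.HodgeRepro2.T6A2WeilSituation
import Summits.Ventures.HodgeRepro2.T6A2HypHost
import Summits.Ventures.HodgeRepro2.T6A2WeilUnitAV

/-!
# T6A2WeilTensor — smoothness and geometric irreducibility of products and of the base point are theorems

Cell pub-hodge-repro2, Tier 6 (README §10), seat t6-p2 (A2 host side). Of the three clauses of the host's
`IsSmoothProjective` for a product `X ⊗ Y` (the fibre product over the base point, `Over.tensorObj_hom`:
`(X ⊗ Y).hom = pullback.fst X.hom Y.hom ≫ X.hom`) two are Mathlib theorems: smoothness of relative
dimension `n + m` (base change `smoothOfRelativeDimension_isStableUnderBaseChange` + composition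
`smoothOfRelativeDimension_comp`) and geometric irreducibility (`GeometricallyIrreducible.comp` of the base
change and of `X.hom`, both universally open since smooth ⇒ flat, locally of finite presentation). Likewise for
the base point `𝟙_ (SchemeOver k)` (`Over.tensorUnit_hom : (𝟙_ _).hom = 𝟙 _`): the identity is an open
immersion, hence smooth of relative dimension `0`, and geometrically irreducible (every base change is
`Spec K`, a one-point space). Only PROJECTIVITY of the product / of the point is not in Mathlib (the Segre
embedding; `Proj k[x₀] ≅ Spec k`) — it stays a display (T6A2HypHost), and this file turns the displays into the
host's named Props `IsSmoothProjective.tensor` / `isSmoothProjective_unit` (the base point's geometric irreducibility is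
T6A2WeilUnitAV's `geometricallyIrreducible_unit`). No `sorry`; standard axioms.
§8(d): uses an L-value-free non-vanishing device: NO.
-/

noncomputable section

namespace Summit.Ventures.HodgeRepro2.T6.WeilInst

open HostAPI.Carriers.AlgebraicGeometry.Motives CategoryTheory AlgebraicGeometry MonoidalCategory
  CategoryTheory.Limits Summit.Ventures.HodgeRepro2.T6.WeilUnitAV

universe u

variable {k : Type u} [Field k]

/-- smoothness of relative dimension `n + m` of a product of smooth varieties over the base point -/
theorem smoothOfRelativeDimension_tensor {n m : ℕ} {X Y : SchemeOver k} (hX : IsSmoothProjective n X)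
    (hY : IsSmoothProjective m Y) : SmoothOfRelativeDimension (n + m) (X ⊗ Y).hom := by
  haveI := hX.smoothOfRelativeDimension
  haveI := hY.smoothOfRelativeDimension
  haveI := smoothOfRelativeDimension_isStableUnderBaseChange (n := m)
  haveI : SmoothOfRelativeDimension m (pullback.fst X.hom Y.hom) :=
    MorphismProperty.pullback_fst X.hom Y.hom hY.smoothOfRelativeDimension
  rw [Nat.add_comm]
  exact inferInstanceAs (SmoothOfRelativeDimension (m + n) (pullback.fst X.hom Y.hom ≫ X.hom))

/-- geometric irreducibility of a product of smooth geometrically irreducible varieties over the base point -/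
theorem geometricallyIrreducible_tensor {n m : ℕ} {X Y : SchemeOver k} (hX : IsSmoothProjective n X)
    (hY : IsSmoothProjective m Y) : GeometricallyIrreducible (X ⊗ Y).hom := by
  haveI := hX.geometricallyIrreducible
  haveI := hY.geometricallyIrreducible
  haveI := hX.smoothOfRelativeDimension
  haveI := hY.smoothOfRelativeDimension
  haveI : Smooth X.hom := SmoothOfRelativeDimension.smooth n X.hom
  haveI : Smooth Y.hom := SmoothOfRelativeDimension.smooth m Y.hom
  exact GeometricallyIrreducible.comp (pullback.fst X.hom Y.hom) X.hom

/-- **A PRODUCT OF SMOOTH PROJECTIVE VARIETIES IS SMOOTH PROJECTIVE, GIVEN THAT IT IS PROJECTIVE**: the two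
other clauses of the host's `IsSmoothProjective` are theorems. -/
theorem isSmoothProjective_tensor_of_projective {n m : ℕ} {X Y : SchemeOver k} (hX : IsSmoothProjective n X)
    (hY : IsSmoothProjective m Y) (hP : IsProjectiveOver (X ⊗ Y)) : IsSmoothProjective (n + m) (X ⊗ Y) where
  smoothOfRelativeDimension := smoothOfRelativeDimension_tensor hX hY
  isProjectiveOver := hP
  geometricallyIrreducible := geometricallyIrreducible_tensor hX hY

/-- the identity of the base point is smooth of relative dimension `0` (an open immersion) -/
theorem smoothOfRelativeDimension_unit : SmoothOfRelativeDimension 0 (𝟙_ (SchemeOver k)).hom :=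
  inferInstanceAs (SmoothOfRelativeDimension 0 (𝟙 (Spec (CommRingCat.of k))))

/-- **THE BASE POINT IS SMOOTH PROJECTIVE OF DIMENSION 0, GIVEN THAT IT IS PROJECTIVE** -/
theorem isSmoothProjective_unit_of_projective (hP : IsProjectiveOver (𝟙_ (SchemeOver k))) :
    IsSmoothProjective 0 (𝟙_ (SchemeOver k)) where
  smoothOfRelativeDimension := smoothOfRelativeDimension_unit
  isProjectiveOver := hP
  geometricallyIrreducible := geometricallyIrreducible_unit k

/-- **THE HOST'S NAMED PROP `IsSmoothProjective.tensor` FROM THE PROJECTIVITY DISPLAY** (every `n m X Y`). -/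
theorem tensor_of_display (h : Hyp.Hartshorne1977_productProjective) :
    ∀ (n m : ℕ) (X Y : SchemeOver ℂ), IsSmoothProjective.tensor (n := n) (m := m) (X := X) (Y := Y) :=
  fun _ _ X Y hX hY => isSmoothProjective_tensor_of_projective hX hY (h X Y hX.isProjectiveOver hY.isProjectiveOver)

/-- **THE HOST'S NAMED PROP `isSmoothProjective_unit ℂ` FROM THE PROJECTIVITY DISPLAY**. -/
theorem unit_of_display (h : Hyp.Hartshorne1977_pointProjective) : isSmoothProjective_unit ℂ :=
  isSmoothProjective_unit_of_projective h

end Summit.Ventures.HodgeRepro2.T6.WeilInst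

end
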